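import Literature.MathematicalPhysics.QuantumFieldTheory.Balaban1983to89.B9Thm37KLetterDir

/-!
# `Balaban1983to89.B9RWSums346MixedPairDir` — the mixed L² member (3.46) of Theorem 3.7's sum G′(U), per direction pair, OVER THE DIRECTION LETTERS (ruling R1′):
# n06-k's `B9RWSums346MixedPair.{l2mixed_of_local37, blockBd_mixed_family_37}` with `Identities₂`, `fixedPoint_dir` and `FactorsL2Mixed37Dir` — engine re-thread (A3), file 3

T. Bałaban, *Propagators for lattice gauge theories in a background field*, Commun. Math. Phys. **99** (1985) 389–434
[`Balaban1985BackgroundPropagators`, "B9"], Thm 3.7 (3.87)–(3.90) pp. 408–410, (3.46) p. 398, (3.42) p. 397, p. 391; T. Bałaban, *Propagators and renormalization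
transformations for lattice gauge theories. II*, Commun. Math. Phys. **96** (1984) 223–250 [`Balaban1984PropagatorsII`, "[4]"], (2.52)–(2.55) p. 232, Lemma 2.1 p. 234.

statement-level skeleton of published theorems with citation tags; proofs where landed; nothing here is a claim about the
Yang–Mills mass gap

WHY THIS FILE (cell `pub-ymgap`, Track A node N06 [B9], rows 18–19; dag-n06-d g10 «re-thread the engine over Identities₂»; seat `pub-ymgap-dag-n06-c` g10).
Recipe of `B9RWSums346TwoGpDir`: `hi : Identities₂`, `hfix := fixedPoint_dir hi`, K-letter `KopDir`, schema `FactorsL2Mixed37Dir`; the private algebra helpers of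
the v1 file are copied (they are private there).  Statements, constants and every other hypothesis verbatim.

HONEST SCOPE.  Majorant bookkeeping over n06-k's landed L² calculus; the L² legs, the factor bounds and (3.88) are HYPOTHESES (schemas); nothing of [B9] asserted;
COUNT-NEUTRAL; N06 NOT discharged; one finite lattice programme — nothing continuum, nothing about OS positivity or the mass gap.
-/

namespace Literature.MathematicalPhysics.QuantumFieldTheory.Balaban1983to89.B9RWSums346MixedPairDir

open Finset B6RandomWalk B6RandomWalkHom B9Thm37Sum B9Thm34Ext B9Thm37Glue B9Thm37Whole B9Cor38Whole
open B9RWSums343to347Whole B9RWSums346Schur B9Thm37GlueCor36 B9RWSums343Holder B9RWSums343HolderGp B9RWSums346Lap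
open B9RWSums344Input B9RWSums344InputGp B9RWSums346Two B9RWSums346TwoGp B11SectG B9Thm37AllNorms B9SectDL2Decay B9RWSums346SecondDiff
open B9RWSums346SecondDiffGp B9RWSums346MixedPair B9Thm37WholeDir B9Thm37KLetterDir

noncomputable section

section Algebra

variable {g : B9.Geometry} [Fintype g.Site] {R : ℝ} {H : Prop} {X Z : Type} [Fintype X] [Fintype Z]

omit [Fintype g.Site] [Fintype X] [Fintype Z] in
/-- Algebra of (3.106)∕(3.88) read between two operators: L∘(G∘D) = Σ-free form L∘(G₀∘D) + (L∘G)∘(W∘D) from G = G₀ + G·W. [folklore] -/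
private theorem sandwich_split {L Dst G G0 W : Module.End ℝ (X → ℝ)} (h : G = G0 + G * W) :
    L ∘ₗ (G ∘ₗ Dst) = L ∘ₗ (G0 ∘ₗ Dst) + (L ∘ₗ G) ∘ₗ (W ∘ₗ Dst) := by
  conv_lhs => rw [h]
  apply LinearMap.ext
  intro f
  simp only [LinearMap.comp_apply, LinearMap.add_apply, Module.End.mul_apply, map_add]

omit [Fintype g.Site] [Fintype X] [Fintype Z] in
/-- a left factor distributes over a finite sum of operators composed on the right. [folklore] -/
private theorem comp_sum_comp {ι : Type} [Fintype ι] (L Dst : Module.End ℝ (X → ℝ)) (T : ι → Module.End ℝ (X → ℝ)) :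
    L ∘ₗ ((∑ i, T i) ∘ₗ Dst) = ∑ i, L ∘ₗ (T i ∘ₗ Dst) := by
  apply LinearMap.ext
  intro f
  simp only [LinearMap.comp_apply, LinearMap.sum_apply, map_sum]

omit [Fintype g.Site] [Fintype X] [Fintype Z] in
/-- a finite sum of operators composed on the right. [folklore] -/
private theorem sum_comp' {ι : Type} [Fintype ι] (Dst : Module.End ℝ (X → ℝ)) (T : ι → Module.End ℝ (X → ℝ)) :
    (∑ i, T i) ∘ₗ Dst = ∑ i, T i ∘ₗ Dst := by
  apply LinearMap.ext
  intro f
  simp only [LinearMap.comp_apply, LinearMap.sum_apply]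

/-- L² block bounds add. [folklore] -/
private theorem blockBd_add₃ (blk₁ : X → g.Site) (blk₂ : Z → g.Site) {T₁ T₂ : (X → ℝ) →ₗ[ℝ] (Z → ℝ)}
    {K₁ K₂ : g.Site → g.Site → ℝ} (h₁ : BlockBd (g := toB6 g R H) blk₁ blk₂ T₁ K₁)
    (h₂ : BlockBd (g := toB6 g R H) blk₁ blk₂ T₂ K₂) :
    BlockBd (g := toB6 g R H) blk₁ blk₂ (T₁ + T₂) (fun a b => K₁ a b + K₂ a b) := by
  rw [blockBd_iff_hasMaj] at h₁ h₂ ⊢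
  exact h₁.add h₂

end Algebra

section GpSide

variable {g : B9.Geometry} [Fintype g.Site] [DecidableEq g.Site] {R : ℝ} {H : Prop} {B : B9.Backgrounds}
variable {X Y ι P : Type} [Fintype P]

/-- ★★ **THE MIXED L² MEMBER OF (3.46) FOR THE SUM G′(U) OF (3.90), PER DIRECTION PAIR, OVER THE DIRECTION LETTERS** — `B9RWSums346MixedPair.l2mixed_of_local37` with
`Identities₂`, `fixedPoint_dir` (`R′ = Σ_□ KopDir·G′_□·M_h`) and `FactorsL2Mixed37Dir`; statement, constants (`mixedConst`) and proof otherwise verbatim.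
[cite: Balaban1985BackgroundPropagators, Thm 3.7 (3.87)–(3.90) pp.408–410 + (3.46) p.398 + (3.42) p.397 + p.391; Balaban1984PropagatorsII, (2.52)–(2.55) p.232 + Lemma 2.1 p.234] -/
theorem l2mixed_of_local37_dir [Fintype X] [DecidableEq X] [Fintype Y] [Fintype ι]
    (𝔬 : Ops g B X Y ι) (𝔡 : DirOps37 𝔬 P) (𝔩 : DirLetters37 𝔬 P) (R : ℝ) (H : Prop) (d d₁ : ℕ) (δ α L₀ δ₁ α₁ ρ N N' Cℓ NM BM θM C : ℝ) (κ : Sizes)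
    (SM : ι → Finset g.Site) (U : B.Cfg)
    (hN' : 0 ≤ N') (hNM : 0 ≤ NM) (hBM : 0 ≤ BM) (hθM : 0 ≤ θM) (hC : 0 ≤ C)
    (hα2 : 2 * α * δ ≤ δ) (hα₁δ₁ : 0 ≤ α₁ * δ₁) (hrate : (1 - 2 * α) * δ ≤ (1 - α₁) * δ₁)
    (hs : StaticOK 𝔬 ρ N N' Cℓ κ) (hcntM : ∀ a : g.Site, (∑ i, if a ∈ SM i then (1 : ℝ) else 0) ≤ NM)
    (h261 : Ineq261 d₁ (toB6 g R H) δ₁ α₁) (hF : Facts347 g R H d δ α L₀) (hi : Identities₂ 𝔬 𝔡 𝔩 R H U)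
    (hL : L2MixedLegs37 𝔬 𝔡 R H SM BM δ₁ U) (hFL : FactorsL2Mixed37Dir 𝔬 𝔡 𝔩 R H θM δ₁ U)
    (hDS : DirSup37 𝔬 𝔡 R H U) (hDT : DirTranspose37 𝔬 𝔡 U)
    (h1 : HasMajorantHom (g := toB6 g R H) 𝔬.blk 𝔬.blkY (𝔬.D U ∘ₗ 𝔬.Gp U)
      (fun (a b : g.Site) => C * g.len a * Real.exp (-(δ * g.dist a b))))
    (h2 : HasMajorantHom (g := toB6 g R H) 𝔬.blkY 𝔬.blk (𝔬.Gp U ∘ₗ 𝔬.Dstar U)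
      (fun (a b : g.Site) => C * g.len a * Real.exp (-(δ * g.dist a b))))
    (hsym : IsTransposePair (𝔬.Gp U) (𝔬.Gp U)) (ν μ : P) :
    BlockBd (g := toB6 g R H) 𝔬.blk 𝔬.blk (𝔡.Dd U ν ∘ₗ (𝔬.Gp U ∘ₗ 𝔡.Dsd U μ))
      (fun (a b : g.Site) => mixedConst d₁ δ₁ α₁ NM BM N' θM C L₀ * Real.exp (-((1 - 2 * α) * δ * g.dist a b))) := by
  have hlen0 : ∀ y : g.Site, 0 ≤ g.len y := fun y => (hs.lenpos y).le
  have htri : Triangle254 (toB6 g R H) := fun a b c => hs.tri a b c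
  have hc1 : 0 ≤ B6.c1 d₁ δ₁ α₁ := c1_nonneg d₁ δ₁ α₁
  have hL₀ : 0 ≤ L₀ := le_trans (le_trans zero_le_one hF.one_le_L) hF.L_le
  have hρ'0 : 0 ≤ (1 - 2 * α) * δ := by nlinarith [hα2]
  have hexp : ∀ a b : g.Site, Real.exp (-(δ₁ * g.dist a b)) ≤ Real.exp (-((1 - 2 * α) * δ * g.dist a b)) := fun a b =>
    Real.exp_le_exp.mpr (neg_le_neg (mul_le_mul_of_nonneg_right (by nlinarith [hrate, hα₁δ₁]) (hs.dnn a b)))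
  -- (3.88), read between ∇_ν and ∇*_μ
  have hfix : 𝔬.Gp U = (∑ i, mulOp (𝔬.h i) * 𝔬.Gsq U i * mulOp (𝔬.h i)) +
      𝔬.Gp U * ∑ i, KopDir 𝔬 𝔡 𝔩 U i * 𝔬.Gsq U i * mulOp (𝔬.h i) :=
    fixedPoint_dir hi
  have hsplit : 𝔡.Dd U ν ∘ₗ (𝔬.Gp U ∘ₗ 𝔡.Dsd U μ) =
      (∑ i, 𝔡.Dd U ν ∘ₗ ((mulOp (𝔬.h i) * 𝔬.Gsq U i * mulOp (𝔬.h i)) ∘ₗ 𝔡.Dsd U μ)) +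
        (𝔡.Dd U ν ∘ₗ 𝔬.Gp U) ∘ₗ ((∑ i, KopDir 𝔬 𝔡 𝔩 U i * 𝔬.Gsq U i * mulOp (𝔬.h i)) ∘ₗ 𝔡.Dsd U μ) := by
    rw [sandwich_split hfix, comp_sum_comp]
  have hP : BlockBd (g := toB6 g R H) 𝔬.blk 𝔬.blk
      ((∑ i, KopDir 𝔬 𝔡 𝔩 U i * 𝔬.Gsq U i * mulOp (𝔬.h i)) ∘ₗ 𝔡.Dsd U μ)
      (fun (y y' : g.Site) => N' * θM * g.len y ^ (-(1 : ℝ)) * Real.exp (-(δ₁ * g.dist y y'))) := by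
    rw [sum_comp']
    have h := blockBd_localSum (R := R) (H := H) 𝔬.blk 𝔬.blk
      (fun i => (KopDir 𝔬 𝔡 𝔩 U i * 𝔬.Gsq U i * mulOp (𝔬.h i)) ∘ₗ 𝔡.Dsd U μ)
      (fun i (y : g.Site) => if y ∈ 𝔬.S' i then (1 : ℝ) else 0)
      (fun (y y' : g.Site) => θM * g.len y ^ (-1 : ℝ) * Real.exp (-(δ₁ * g.dist y y'))) N'
      (fun y y' => mul_nonneg (mul_nonneg hθM (Real.rpow_nonneg (hlen0 y) _)) (Real.exp_nonneg _))
      (fun i => hFL.facDs i μ) hs.cnt'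
    exact h.mono fun y y' => le_of_eq (by ring)
  have h1ν := hDS.left _ h1 ν
  have h2ν := hDS.right _ h2 ν
  have htrν : IsTransposePair (𝔡.Dd U ν ∘ₗ 𝔬.Gp U) (𝔬.Gp U ∘ₗ 𝔡.Dsd U ν) := hsym.comp (hDT.tr ν).symm
  have hS1 := blockBd_entry1 hF hC hs.symm hs.lenpos 𝔬.blk 𝔬.blk h1ν h2ν htrν
  have hS : BlockBd (g := toB6 g R H) 𝔬.blk 𝔬.blk (𝔡.Dd U ν ∘ₗ 𝔬.Gp U)
      (fun (a b : g.Site) => C * L₀ * g.len a ^ (1 : ℝ) * Real.exp (-((1 - α) * δ * g.dist a b))) :=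
    hS1.mono fun a b => by rw [Real.rpow_one]
  have hρ : (1 - α) * δ = α * δ + (1 - 2 * α) * δ := by ring
  have htail := comp_l2_transfer (R := R) (H := H) 𝔬.blk 𝔬.blk 𝔬.blk hF h261 htri hs.symm hs.dnn hs.lenpos (mul_nonneg hC hL₀)
    (mul_nonneg hN' hθM) hρ hρ'0 hrate (by rw [abs_one]; norm_num) hS hP
  have hhead := blockBd_localSum (R := R) (H := H) 𝔬.blk 𝔬.blk
    (fun i => 𝔡.Dd U ν ∘ₗ ((mulOp (𝔬.h i) * 𝔬.Gsq U i * mulOp (𝔬.h i)) ∘ₗ 𝔡.Dsd U μ))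
    (fun i (a : g.Site) => if a ∈ SM i then (1 : ℝ) else 0) (fun (a b : g.Site) => BM * Real.exp (-(δ₁ * g.dist a b))) NM
    (fun a b => mul_nonneg hBM (Real.exp_nonneg _)) (fun i => hL.lm i ν μ) hcntM
  rw [hsplit]
  refine (blockBd_add₃ (R := R) (H := H) 𝔬.blk 𝔬.blk hhead htail).mono fun a b => ?_
  have hK0 : 0 ≤ NM * BM := mul_nonneg hNM hBM
  rw [abs_one, Real.rpow_one]
  calc NM * (BM * Real.exp (-(δ₁ * g.dist a b))) +
        C * L₀ * (N' * θM) * L₀ * B6.c1 d₁ δ₁ α₁ * Real.exp (-((1 - 2 * α) * δ * g.dist a b))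
      = NM * BM * Real.exp (-(δ₁ * g.dist a b)) +
        C * L₀ * (N' * θM) * L₀ * B6.c1 d₁ δ₁ α₁ * Real.exp (-((1 - 2 * α) * δ * g.dist a b)) := by ring
    _ ≤ NM * BM * Real.exp (-((1 - 2 * α) * δ * g.dist a b)) +
        C * L₀ * (N' * θM) * L₀ * B6.c1 d₁ δ₁ α₁ * Real.exp (-((1 - 2 * α) * δ * g.dist a b)) :=
        add_le_add (mul_le_mul_of_nonneg_left (hexp a b) hK0) le_rfl
    _ = mixedConst d₁ δ₁ α₁ NM BM N' θM C L₀ * Real.exp (-((1 - 2 * α) * δ * g.dist a b)) := by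
        unfold mixedConst; ring


/-- ★ **THE PACKAGED FAMILY ∇_{U,ν}G′∇\*_{U,μ} OVER THE PAIRS (ν, μ) ∈ P × P** has the L² block bound |P|·`mixedConst …`·e^{−(1−2α)δd}.
[cite: Balaban1985BackgroundPropagators, (3.46) p.398 + (3.39) p.397] -/
theorem blockBd_mixed_family_37_dir [Fintype X] [DecidableEq X] [Fintype Y] [Fintype ι]
    (𝔬 : Ops g B X Y ι) (𝔡 : DirOps37 𝔬 P) (𝔩 : DirLetters37 𝔬 P) (R : ℝ) (H : Prop) (d d₁ : ℕ) (δ α L₀ δ₁ α₁ ρ N N' Cℓ NM BM θM C : ℝ) (κ : Sizes)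
    (SM : ι → Finset g.Site) (U : B.Cfg)
    (hN' : 0 ≤ N') (hNM : 0 ≤ NM) (hBM : 0 ≤ BM) (hθM : 0 ≤ θM) (hC : 0 ≤ C)
    (hα2 : 2 * α * δ ≤ δ) (hα₁δ₁ : 0 ≤ α₁ * δ₁) (hrate : (1 - 2 * α) * δ ≤ (1 - α₁) * δ₁)
    (hs : StaticOK 𝔬 ρ N N' Cℓ κ) (hcntM : ∀ a : g.Site, (∑ i, if a ∈ SM i then (1 : ℝ) else 0) ≤ NM)
    (h261 : Ineq261 d₁ (toB6 g R H) δ₁ α₁) (hF : Facts347 g R H d δ α L₀) (hi : Identities₂ 𝔬 𝔡 𝔩 R H U)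
    (hL : L2MixedLegs37 𝔬 𝔡 R H SM BM δ₁ U) (hFL : FactorsL2Mixed37Dir 𝔬 𝔡 𝔩 R H θM δ₁ U)
    (hDS : DirSup37 𝔬 𝔡 R H U) (hDT : DirTranspose37 𝔬 𝔡 U)
    (h1 : HasMajorantHom (g := toB6 g R H) 𝔬.blk 𝔬.blkY (𝔬.D U ∘ₗ 𝔬.Gp U)
      (fun (a b : g.Site) => C * g.len a * Real.exp (-(δ * g.dist a b))))
    (h2 : HasMajorantHom (g := toB6 g R H) 𝔬.blkY 𝔬.blk (𝔬.Gp U ∘ₗ 𝔬.Dstar U)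
      (fun (a b : g.Site) => C * g.len a * Real.exp (-(δ * g.dist a b))))
    (hsym : IsTransposePair (𝔬.Gp U) (𝔬.Gp U)) :
    BlockBd (g := toB6 g R H) 𝔬.blk (𝔬.blk ∘ Prod.fst)
      (familyOp fun p : P × P => 𝔡.Dd U p.1 ∘ₗ (𝔬.Gp U ∘ₗ 𝔡.Dsd U p.2))
      (fun (a b : g.Site) => (Fintype.card P : ℝ) * mixedConst d₁ δ₁ α₁ NM BM N' θM C L₀ *
        Real.exp (-((1 - 2 * α) * δ * g.dist a b))) := by
  have hL₀ : 0 ≤ L₀ := le_trans (le_trans zero_le_one hF.one_le_L) hF.L_le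
  have hK : 0 ≤ mixedConst d₁ δ₁ α₁ NM BM N' θM C L₀ := mixedConst_nonneg hNM hBM hN' hθM hC hL₀
  have h := blockBd_familyOp (R := R) (H := H) 𝔬.blk 𝔬.blk (P := P × P)
    (T := fun p : P × P => 𝔡.Dd U p.1 ∘ₗ (𝔬.Gp U ∘ₗ 𝔡.Dsd U p.2))
    (fun a b => mul_nonneg hK (Real.exp_nonneg _))
    (fun p => l2mixed_of_local37_dir 𝔬 𝔡 𝔩 R H d d₁ δ α L₀ δ₁ α₁ ρ N N' Cℓ NM BM θM C κ SM U hN' hNM hBM hθM hC hα2 hα₁δ₁ hrate hs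
      hcntM h261 hF hi hL hFL hDS hDT h1 h2 hsym p.1 p.2)
  refine h.mono fun a b => le_of_eq ?_
  rw [Fintype.card_prod, Nat.cast_mul, Real.sqrt_mul_self (Nat.cast_nonneg _)]
  ring

end GpSide

end

end Literature.MathematicalPhysics.QuantumFieldTheory.Balaban1983to89.B9RWSums346MixedPairDir
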